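/-
Origin: expansion seat `planner-pub-hodgecm-mc-axioms-1-g10-0`, handover #1 2026-08-19T16:26Z md5 dda83f0b81dd855d42d725cd99453e87 (305 l.) WHOLE-FILE REPLACEMENT of `Model/LevelDescent.lean` (PKG 77700e98f337, 282 l. = kit t35-mcaxioms1g6 #1 8916c41de22a + packager Origin block) — RUN-37 `K`-ORDER TWIN: `Universe.ThetaModel.isotypic_of_small` / `thetaAlbanese_of_small` / `fact_thetaAlbanese_of_small` re-typed per §57/§60: `hsmall : … ∀ i, ∃ Γ₀, ∀ Γ ≤ Γ₀, ∃ M k σ', …` in the (W1) K-order; `hΘ` along `(h : Γ₁ ≤ Γ)` over `T.cover Γ Γ₁ (Level.Γ_mono h)`; the transfer DATA family `D Γ Γ₁ (h : Γ₁.Γ ≤ Γ.Γ)` keeps the `.Γ`-order; descent level = `Level.exists_le_le Γ Γ₀` of the (W1) root (no order lemma of its own). `Universe.LevelTransfer`, `mem_Uiso_of_pullC_mem`, `refl`, the averaging kernel BYTE-IDENTICAL to 8916c41de22a. Imports `HodgeCM.PerL34.ThetaSubOfLiu` only. Needs #342 (t37-mcglue1g6) installed first; install WITH #2–#4 of this kit.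 CERT (A): (W1) world rc 0, 0 warnings, trio ×4. (`HOME/mc/pub-hodgecm-mc-axioms-1-g10/lean/w1/HodgeCM/Model/LevelDescent.lean`, md5 dda83f0b, 305 lines);
landed by the gen-13 packager (p-g13) in gate run 37 REPLACES the earlier landed copy of `HodgeCM/Model/LevelDescent.lean` (verbatim).
-/
/-
RUN-37 `K`-ORDER TWIN by CONSTRUCTION seat `planner-pub-hodgecm-mc-axioms-1-g10-0` (unit
pub-hodgecm-mc-axioms-1-g10, gen 10 of mc-axioms-1, MODEL-DAG node N-i1 (L-lvl)), 2026-08-19, of the installed RUN-35 row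
`HodgeCM/Model/LevelDescent.lean` (kit t35-mcaxioms1g6 #1 8916c41de22a, installed 77700e98f337).  RE-TYPING OF RECORD
(model1-g6 BINDER-TRIAGE §57 (Θ-sat-K) + §60 (Θ-sat-≤); ±0 binders, no statement strengthened):
  * the level order is (W1)'s `K`-ORDER `Γ' ≤ Γ :↔ Γ'.K ≤ Γ.K` (`instance : PartialOrder (Level V)` of the (W1)
    `CM/Basic.lean` REPLACE; PerL l. 533 «K'_f ⊆ K_f», [Liu21] «K sufficiently small»);
  * `hsmall : ∃ Γ₀, ∀ Γ ≤ Γ₀, …` now quantifies over the `K`-order (was `Γ.Γ ≤ Γ₀.Γ`) — E then assumes isotypy on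
    FEWER levels (re-typing TOWARD print, §60);
  * the theta-saturation input `hΘ` is stated along `K`-inclusions `(h : Γ₁ ≤ Γ)` over the covering
    `T.cover Γ Γ₁ (Level.Γ_mono h)` (= the re-typed `ThetaModel.Fact_coverTheta`, §60: saturation is inherited along
    `K' ≤ K`, not along `Γ' ≤ Γ` alone);
  * the level-transfer DATA family `D Γ Γ₁ (h : Γ₁.Γ ≤ Γ.Γ)` KEEPS the `.Γ`-order (geometry: coverings exist for any
    nested arithmetic groups; §60), and the descent level is ANY common refinement `Γ₁ ≤ Γ, Γ₁ ≤ Γ₀`, taken from the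
    (W1) root packet's `Level.exists_le_le` (downward directedness of the `K`-order; there `⟨Γ ⊓ Γ₀, inf_le_left, inf_le_right⟩`
    for the PAIR meet of `SemilatticeInf (Level V)`, glue-1-g6 2026-08-19T15:17:44Z «(W1) ANSWER = (a)») — so this file's whole
    (W1)-API surface is `≤`, `Level.Γ_mono`, `Level.exists_le_le`; `D` is applied at `Level.Γ_mono` of `Γ₁ ≤ Γ`.
Everything else (the averaging kernel, `LevelTransfer`, `mem_Uiso_of_pullC_mem`, `refl`) is BYTE-IDENTICAL to 8916c41de22a.
(W1) DEPENDENCY: `PartialOrder (Level V)` (the `K`-order, `Level.le_def`), `Level.Γ_mono`, `Level.exists_le_le` of the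
(W1) ROOT `CM/Basic.lean` = row #342 66bed69a8c74 of glue-1-g6's kit `t37-mcglue1g6.txt` (the `Level`-PAIR packet, RUN 37;
desk (WWWWW′) 2026-08-19T15:54:56Z), reached through `HodgeCM.PerL34.ThetaSubOfLiu`.  INSTALL in the SAME run as #342 and
AFTER it (this file does not elaborate against the RUN-35/36 root ab6125703c20), TOGETHER with this lineage's three wrapper
twins `Model/HLiuOfSmall`, `Model/HLiuOfNorm`, `Model/HLiuOfSmallLevel` (they pass `hsmall` through; the installed ″ wrappers
do not elaborate against this twin).
-/
/-
Origin: CONSTRUCTION seat `planner-pub-hodgecm-mc-axioms-1-g6-0` (unit pub-hodgecm-mc-axioms-1-g6, gen 6 of mc-axioms-1,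
MODEL-DAG node N-i1, ruling (L-lvl) model1 2026-08-19T03:06:38Z / 03:14:11Z), 2026-08-19.  NEW additive leaf
`HodgeCM/Model/LevelDescent.lean` (flat under `Model/`, per carver model1-g5 2026-08-19T06:16:43Z).  Imports: `HodgeCM.PerL34.ThetaSubOfLiu` (the [Liu21] interface shape
`ThetaModel.Fact_thetaAlbanese`, `inflate`, `Universe.Uiso_eq_span`) and — RUN-37 twin — the (W1) level order
(`PartialOrder (Level V)` = `K`-order, `Level.Γ_mono`, `Level.exists_le_le`).
KERNEL ONLY: no `def … : Prop` records, no proof holes; every undischarged input is an explicit binder or a field of the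
DATA structure `Universe.LevelTransfer` below.  Expected `#print axioms`:
{propext, Classical.choice, Quot.sound}.
-/
import Summits.HodgeConjecture.HodgeCM.PerL34.ThetaSubOfLiu_2

/-!
# Level descent of `U_Φ`-isotypy and the transfer lemma `hLiu_of_small`

The E term (`Model.perL_picardCM_rN`, every revision R10–R16) carries the type-I binder

  `hLiu : ∀ V c, GoodCtx ι₁ c → finrank ℚ c.K = 6 → ∀ (i : Fin 4) (Γ : Level V), ∃ M k σ', σ' ∘ k = c.σ ∧
      Theta V c i Γ ⊆ U.Uiso Γ M (inflate k (c.Ψ i)) σ'`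

(= `ThetaModel.Fact_thetaAlbanese` restricted to sextic contexts).  Its print source, [Liu21] Thm 4.15 + Thm 4.18(1) +
Prop 4.13, is stated at SUFFICIENTLY SMALL level ("for `K ⊆ K₀`"), so the record writable at the S/W pin (RUN 35+) has
the shape `∃ Γ₀ : Level V, ∀ Γ ≤ Γ₀, <isotypy at Γ>` (ruling (L-lvl)).  Passing from small levels to ALL torsion-free
congruence levels is elementary geometry (dossier `N-i1-dossier.md` §12, DERIVATION D5): for a finite covering
`p : P_{Γ₁} → P_Γ` of degree `d`, a class `c ∈ H¹(P_Γ)` with `p^*c = Σ_j λ_j F_j^*α_j` (`F_j : P_{Γ₁} → A`) satisfies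
`d·c = p_*p^*c = Σ_j λ_j (N F_j)^*α_j` where `N F : P_Γ → A` is the NORM (fibre sum, group law of `A`) of `F`, so
`c ∈ U_Φ(Γ)`.  The universe `HodgeCM.Universe` has neither transfer maps nor a group law on `cmAV`; per (L-lvl) these
are NEW G-universe DATA (d1) level-change coverings + deck group + transfer, (d2) group law on `cmAV` with
`H¹`-additivity, (d3) free-finite-quotient descent — to be CONSTRUCTED on `Model.picardCMUniverse` by the universe /
glue lanes (RUN 35+).  This file supplies, over the ABSTRACT universe `U`:

* `Universe.LevelTransfer p` — the honest-interface DATA attached to ONE covering morphism `p : P_{Γ₁} → P_Γ` of the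
  universe (for the theta model: `p = T.cover Γ Γ₁ h`, i.e. `Model.coverOf …` for E), TRANSFER FORM (the cohomological
  consequence of (d1)–(d3) that the proof uses, stated on `H¹(−, ℚ)`): the degree `deg > 0`, the transfer `push = p_*`
  with `p_* ∘ p^* = deg • id`, and the norm `norm F = N_F` of morphisms to CM abelian varieties with
  `p_* ∘ F^* = (N_F)^*`.  No normality of `Γ₁` in `Γ` is needed.  Intended model: `p_*` = the transfer (Gysin map in
  degree one) of the finite étale covering `P_{Γ₁} → P_Γ`; `N_F = σ_d ∘ Sym^d(F) ∘ φ_p` (`φ_p : P_Γ → Sym^d P_{Γ₁}` the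
  fibre map, `σ_d : Sym^d A → A` the sum); the two identities are `τ^*π^* = n` for an `n`-sheeted covering
  (Hatcher, *Algebraic Topology* §3.G p. 321, and Prop. 3G.1: `π^*` injective with image the deck-invariants,
  `π^*τ^* = Σ_γ γ^*`, coefficients of characteristic `0`; algebraically SGA4 XVII §6.2, the trace morphism of a finite
  locally free morphism), and `H¹`-ADDITIVITY `(f+g)^* = f^* + g^*` on `H¹(A)` for maps to a complex torus `A`
  (Birkenhake–Lange, *Complex Abelian Varieties* §1.2: the rational representation `ρ_r : Hom(X,X') → Hom_ℤ(Λ,Λ')` is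
  a homomorphism of abelian groups, with `H¹(X,ℤ) = Hom_ℤ(Λ,ℤ)` §1.3; maps `S → A` factor through `Alb(S)` up to
  translation, and translations act trivially on `H¹`).  These are POINTERS for the instance lanes, not cited facts.
  (Ruling model1-g5 2026-08-19T06:16:43Z (Q1): this TRANSFER form is the data form OF RECORD for the instance lanes; the
  GALOIS / deck-group form — deck maps with `deck g ≫ p = p`, `p^*` injective, `p^* ∘ (N_F)^* = Σ_g (deck g)^* ∘ F^*`,
  needing `Γ₁ ⊴ Γ` — is kept OUT of the package as a documented alternative with the same kernel bridge, in the seat's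
  `scratch/GaloisCoverAlt.lean`; no instance of it is planned.)
* KERNEL `Universe.mem_Uiso_of_averaging` (the one averaging argument, stated for an abstract averaging operator so
  that it serves the transfer form here and the deck form alike), `LevelTransfer.mem_Uiso_of_pullC_mem` (level descent
  of isotypy: `p^*c ∈ U_Φ(Γ₁) → c ∈ U_Φ(Γ)`).
* KERNEL `ThetaModel.isotypic_of_small` and the E-shaped `ThetaModel.thetaAlbanese_of_small` (= `hLiu_of_small`):
  from a FAMILY of level-transfer data on the model's OWN coverings `T.cover Γ Γ₁ h` (one for every pair `Γ₁ ≤ Γ`),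
  the saturation of the theta forms under those coverings (`p^* Θ_i(Γ) ⊆ Θ_i(Γ₁)` — literally the statement
  `ThetaModel.Fact_coverTheta` of `Automorphic/HeckeWedge.lean`; for the E model it is E's former binder `thetaSat`,
  DISCHARGED since revision 10 by `Model.thetaSatOf` modulo E's binder `hι` — so it is NOT a new input), and the
  SMALL-LEVEL isotypy `∀ i, ∃ Γ₀, ∀ Γ ≤ Γ₀, …` (the [Liu21] record shape), conclude the binder `hLiu` VERBATIM (for `Γ`
  arbitrary use a common refinement `Γ₁ ≤ Γ, Γ₁ ≤ Γ₀` in the `K`-order of (W1), `Level.exists_le_le`).  Net inputs of `hLiu` after this file: the DATA family `D` (RUN 35+,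
  universe / glue lanes) and the small-level record.
* SANITY inhabitant `LevelTransfer.refl` (identity covering, degree 1; needs M1 `Fact_pull_id`).

Nothing here is a cited fact; the structure is a DATA binder (honest interface: operations + their two defining
identities, no existence smuggled), the theorems are kernel-checked.
-/

noncomputable section

open scoped TensorProduct

namespace HodgeCM

open Literature.AlgebraicGeometry.Motives (CMType)
open CMTypeOps (inflate)

namespace Universe

variable {U : Universe}

/-! ### The averaging argument (abstract kernel) -/

section Averaging

variable {L : CMField} {ι₁ : L →+* ℂ} {V : HermSpace3 L ι₁} {Γ Γ₁ : Level V}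

/-- **Level descent of isotypy, abstract form.**  Let `p : P_{Γ₁} → P_Γ`, and let `avg` be a `ℂ`-linear endomorphism
of `H¹(P_{Γ₁}, ℂ)` (think `p^* ∘ p_*`, or `Σ_g g^*` over a deck group) such that `avg ∘ p^* = d • p^*` with `d ≠ 0`,
`p^*` is injective on `H¹`, and for every morphism `F : P_{Γ₁} → A_{(K,Ψ)}` there is `N F : P_Γ → A_{(K,Ψ)}` with
`avg (F^*α) = p^*((N F)^*α)` for all `α ∈ H¹(A_{(K,Ψ)}, ℂ)`.  Then `p^*c ∈ U_{(K,Ψ,σ)}(Γ₁)` implies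
`c ∈ U_{(K,Ψ,σ)}(Γ)`. -/
theorem mem_Uiso_of_averaging (p : U.Mor (U.pms L ι₁ V Γ₁) (U.pms L ι₁ V Γ))
    (avg : U.CohC (U.pms L ι₁ V Γ₁) 1 →ₗ[ℂ] U.CohC (U.pms L ι₁ V Γ₁) 1) (d : ℂ) (hd : d ≠ 0)
    (hinj : Function.Injective (U.pullC p 1))
    (havg : ∀ c : U.CohC (U.pms L ι₁ V Γ) 1, avg (U.pullC p 1 c) = d • U.pullC p 1 c)
    (K : CMField) (Ψ : CMType K) (σ : K →+* ℂ)
    (N : U.Mor (U.pms L ι₁ V Γ₁) (U.cmAV K Ψ) → U.Mor (U.pms L ι₁ V Γ) (U.cmAV K Ψ))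
    (hN : ∀ (F : U.Mor (U.pms L ι₁ V Γ₁) (U.cmAV K Ψ)) (α : U.CohC (U.cmAV K Ψ) 1),
      avg (U.pullC F 1 α) = U.pullC p 1 (U.pullC (N F) 1 α))
    {c : U.CohC (U.pms L ι₁ V Γ) 1} (hc : U.pullC p 1 c ∈ U.Uiso Γ₁ K Ψ σ) :
    c ∈ U.Uiso Γ K Ψ σ := by
  -- `avg` maps `U_Ψ(Γ₁)` into `p^*(U_Ψ(Γ))`
  have hmap : ∀ x ∈ U.Uiso Γ₁ K Ψ σ, avg x ∈ (U.Uiso Γ K Ψ σ).map (U.pullC p 1) := by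
    intro x hx
    rw [Uiso_eq_span] at hx
    induction hx using Submodule.span_induction with
    | mem x hx =>
      obtain ⟨F, α, hα, rfl⟩ := hx
      rw [hN]
      exact Submodule.mem_map_of_mem (Submodule.subset_span ⟨N F, α, hα, rfl⟩)
    | zero => simp
    | add x y _ _ hx hy => simpa only [map_add] using add_mem hx hy
    | smul a x _ hx => simpa only [map_smul] using Submodule.smul_mem _ a hx
  obtain ⟨u, hu, hpu⟩ := Submodule.mem_map.1 (hmap _ hc)
  rw [havg, ← map_smul] at hpu
  rw [hinj hpu] at hu
  exact (Submodule.smul_mem_iff _ hd).1 hu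

end Averaging

/-! ### Level-descent DATA, transfer form -/

/-- **Level-descent datum on a covering `p : P_{Γ₁} → P_Γ` (TRANSFER FORM; honest interface — data + its two defining
identities, over `H¹(−, ℚ)`).**  Intended model: `p` = the finite étale covering of the tower (tree `LevelCovering`,
`Model.coverOf … Γ Γ₁ h` = `(thetaModelOf …).cover Γ Γ₁ h`), `deg = [Γ : Γ₁]`, `push = p_*` the transfer (degree-one Gysin map) with
`p_* p^* = deg · id` (Hatcher §3.G p. 321 `τ^*π^* = n`; SGA4 XVII §6.2), `norm K Ψ F = N_F : P_Γ → A_{(K,Ψ)}` the norm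
(fibre sum via `Sym^{deg}` and the group law of `A`) with `p_*(F^*α) = N_F^*α` on `H¹` (`H¹`-additivity of pull-backs
to a complex torus, Birkenhake–Lange §1.2–1.3; in the Galois case this is Hatcher Prop. 3G.1 `π^*τ^* = Σ_γ γ^*` plus
`N_F ∘ p = Σ_γ F ∘ γ`).  This is the cohomological consequence of the G-universe data (d1)–(d3) of ruling (L-lvl) that
the descent proof uses; no normality of `Γ₁` in `Γ` is required. -/
structure LevelTransfer (U : Universe) {L : CMField} {ι₁ : L →+* ℂ} {V : HermSpace3 L ι₁} {Γ Γ₁ : Level V}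
    (p : U.Mor (U.pms L ι₁ V Γ₁) (U.pms L ι₁ V Γ)) where
  /-- the degree of `p` -/
  deg : ℕ
  deg_pos : 0 < deg
  /-- the transfer `p_* : H¹(P_{Γ₁}, ℚ) → H¹(P_Γ, ℚ)` -/
  push : U.Coh (U.pms L ι₁ V Γ₁) 1 →ₗ[ℚ] U.Coh (U.pms L ι₁ V Γ) 1
  /-- `p_* ∘ p^* = deg • id` on `H¹(P_Γ, ℚ)` -/
  push_pull : push ∘ₗ U.pull p 1 = (deg : ℚ) • LinearMap.id
  /-- the norm `N_F : P_Γ → A_{(K,Ψ)}` of a morphism `F : P_{Γ₁} → A_{(K,Ψ)}` -/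
  norm : ∀ (K : CMField) (Ψ : CMType K),
    U.Mor (U.pms L ι₁ V Γ₁) (U.cmAV K Ψ) → U.Mor (U.pms L ι₁ V Γ) (U.cmAV K Ψ)
  /-- `p_* ∘ F^* = (N_F)^*` on `H¹(A_{(K,Ψ)}, ℚ)` -/
  push_pull_norm : ∀ (K : CMField) (Ψ : CMType K) (F : U.Mor (U.pms L ι₁ V Γ₁) (U.cmAV K Ψ)),
    push ∘ₗ U.pull F 1 = U.pull (norm K Ψ F) 1

namespace LevelTransfer

variable {L : CMField} {ι₁ : L →+* ℂ} {V : HermSpace3 L ι₁} {Γ Γ₁ : Level V}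
  {p : U.Mor (U.pms L ι₁ V Γ₁) (U.pms L ι₁ V Γ)} (D : U.LevelTransfer p)

include D

/-- the complexified transfer `p_* : H¹(P_{Γ₁}, ℂ) → H¹(P_Γ, ℂ)` -/
def pushC : U.CohC (U.pms L ι₁ V Γ₁) 1 →ₗ[ℂ] U.CohC (U.pms L ι₁ V Γ) 1 :=
  D.push.baseChange ℂ

/-- (Ported verbatim from the HodgeCMPerL package; no docstring in the source.) -/
theorem pushC_comp_pullC : D.pushC ∘ₗ U.pullC p 1 = (D.deg : ℂ) • LinearMap.id := by
  have h := congrArg (fun f : U.Coh (U.pms L ι₁ V Γ) 1 →ₗ[ℚ] U.Coh (U.pms L ι₁ V Γ) 1 => f.baseChange ℂ)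
    D.push_pull
  simp only [LinearMap.baseChange_comp, LinearMap.baseChange_smul, LinearMap.baseChange_id] at h
  refine LinearMap.ext fun c => ?_
  have hc := LinearMap.congr_fun h c
  simp only [LinearMap.comp_apply, LinearMap.smul_apply, LinearMap.id_apply] at hc ⊢
  rw [show ((D.deg : ℚ) • c : U.CohC (U.pms L ι₁ V Γ) 1) = (D.deg : ℂ) • c by
    rw [← algebraMap_smul ℂ (D.deg : ℚ) c, map_natCast]] at hc
  exact hc

/-- (Ported verbatim from the HodgeCMPerL package; no docstring in the source.) -/
theorem pushC_pullC (c : U.CohC (U.pms L ι₁ V Γ) 1) : D.pushC (U.pullC p 1 c) = (D.deg : ℂ) • c := by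
  simpa using LinearMap.congr_fun D.pushC_comp_pullC c

/-- (Ported verbatim from the HodgeCMPerL package; no docstring in the source.) -/
theorem pushC_pullC_mor (K : CMField) (Ψ : CMType K) (F : U.Mor (U.pms L ι₁ V Γ₁) (U.cmAV K Ψ))
    (α : U.CohC (U.cmAV K Ψ) 1) : D.pushC (U.pullC F 1 α) = U.pullC (D.norm K Ψ F) 1 α := by
  have h := congrArg (fun f : U.Coh (U.cmAV K Ψ) 1 →ₗ[ℚ] U.Coh (U.pms L ι₁ V Γ) 1 => f.baseChange ℂ)
    (D.push_pull_norm K Ψ F)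
  simp only [LinearMap.baseChange_comp] at h
  exact LinearMap.congr_fun h α

/-- (Ported verbatim from the HodgeCMPerL package; no docstring in the source.) -/
theorem deg_ne_zero : (D.deg : ℂ) ≠ 0 := Nat.cast_ne_zero.2 D.deg_pos.ne'

/-- `p^*` is injective on `H¹(P_Γ, ℂ)` (from `p_* p^* = deg • id`, `deg ≠ 0`). -/
theorem pullC_cover_injective : Function.Injective (U.pullC p 1) := by
  intro x y h
  have := congrArg D.pushC h
  rw [D.pushC_pullC, D.pushC_pullC] at this
  exact smul_right_injective _ D.deg_ne_zero this

/-- **Level descent of isotypy (transfer form)**: `p^*c ∈ U_{(K,Ψ,σ)}(Γ₁) → c ∈ U_{(K,Ψ,σ)}(Γ)`. -/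
theorem mem_Uiso_of_pullC_mem (K : CMField) (Ψ : CMType K) (σ : K →+* ℂ) {c : U.CohC (U.pms L ι₁ V Γ) 1}
    (hc : U.pullC p 1 c ∈ U.Uiso Γ₁ K Ψ σ) : c ∈ U.Uiso Γ K Ψ σ :=
  U.mem_Uiso_of_averaging p (U.pullC p 1 ∘ₗ D.pushC) (D.deg : ℂ) D.deg_ne_zero
    D.pullC_cover_injective (fun c => by simp [D.pushC_pullC]) K Ψ σ (D.norm K Ψ)
    (fun F α => by simp [D.pushC_pullC_mor]) hc

/-- Equivalently: `(p^*)⁻¹ U_{(K,Ψ,σ)}(Γ₁) ≤ U_{(K,Ψ,σ)}(Γ)`. -/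
theorem comap_Uiso_le (K : CMField) (Ψ : CMType K) (σ : K →+* ℂ) :
    (U.Uiso Γ₁ K Ψ σ).comap (U.pullC p 1) ≤ U.Uiso Γ K Ψ σ :=
  fun _ hc => D.mem_Uiso_of_pullC_mem K Ψ σ hc

omit D in
/-- SANITY inhabitant: the identity covering `P_Γ → P_Γ` of degree `1` (needs M1 `Fact_pull_id`). -/
def refl (h1 : U.Fact_pull_id) (Γ : Level V) : U.LevelTransfer (U.idMor (U.pms L ι₁ V Γ)) where
  deg := 1
  deg_pos := Nat.one_pos
  push := LinearMap.id
  push_pull := by rw [h1, Nat.cast_one, one_smul]; rfl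
  norm _ _ F := F
  push_pull_norm _ _ F := LinearMap.id_comp _

end LevelTransfer

/-! ### The transfer lemma for the theta one-forms (`hLiu_of_small`) -/

namespace ThetaModel

variable (T : U.ThetaModel)

/-- **Isotypy at all levels from isotypy at small levels** (one context, one type index).  Inputs: a FAMILY of
level-transfer data `D Γ Γ₁ h` on the model's coverings `T.cover Γ Γ₁ h`, all pairs `Γ₁.Γ ≤ Γ.Γ` (`.Γ`-order: geometry);
SATURATION of the theta forms under the coverings along `K`-inclusions `Γ₁ ≤ Γ`, `p^* Θ_i(Γ) ⊆ Θ_i(Γ₁)`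
(= the (W1)-re-typed `ThetaModel.Fact_coverTheta` at `(V, c, i)`, BINDER-TRIAGE §60; for E discharged by `Model.thetaSatOf`);
and the SMALL-LEVEL isotypy `∃ Γ₀, ∀ Γ ≤ Γ₀, ∃ (M,k,σ'), …` in the `K`-ORDER ([Liu21] record shape «K sufficiently small»,
rulings (L-lvl) + §60).  Output: isotypy at every level `Γ`, with the `(M, k, σ')` of a small level `Γ₁ ≤ Γ, Γ₁ ≤ Γ₀`
((W1) `Level.exists_le_le`, PerL l. 533 «K'_f ⊆ K_f», [Liu21] «K sufficiently small»). -/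
theorem isotypic_of_small
    (D : ∀ {L : CMField} {ι₁ : L →+* ℂ} {V : HermSpace3 L ι₁} (Γ Γ₁ : Level V) (h : Γ₁.Γ ≤ Γ.Γ),
      U.LevelTransfer (T.cover Γ Γ₁ h))
    {L : CMField} {ι₁ : L →+* ℂ} (V : HermSpace3 L ι₁) (c : SeesawCtx L) (i : Fin 4)
    (hΘ : ∀ (Γ Γ₁ : Level V) (h : Γ₁ ≤ Γ), ∀ ω ∈ T.Theta V c i Γ,
      U.pullC (T.cover Γ Γ₁ (Level.Γ_mono h)) 1 ω ∈ T.Theta V c i Γ₁)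
    (hsmall : ∃ Γ₀ : Level V, ∀ Γ ≤ Γ₀,
      ∃ (M : CMField) (k : c.K →+* M) (σ' : M →+* ℂ), σ'.comp k = c.σ ∧
        T.Theta V c i Γ ⊆ U.Uiso Γ M (inflate k (c.Ψ i)) σ')
    (Γ : Level V) :
    ∃ (M : CMField) (k : c.K →+* M) (σ' : M →+* ℂ), σ'.comp k = c.σ ∧
      T.Theta V c i Γ ⊆ U.Uiso Γ M (inflate k (c.Ψ i)) σ' := by
  obtain ⟨Γ₀, hΓ₀⟩ := hsmall
  obtain ⟨Γ₁, h₁, h₀⟩ := Level.exists_le_le Γ Γ₀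
  obtain ⟨M, k, σ', hσ, hsub⟩ := hΓ₀ Γ₁ h₀
  refine ⟨M, k, σ', hσ, fun ω hω => ?_⟩
  exact (D Γ Γ₁ (Level.Γ_mono h₁)).mem_Uiso_of_pullC_mem M (inflate k (c.Ψ i)) σ' (hsub (hΘ Γ Γ₁ h₁ ω hω))

/-- **`hLiu_of_small` — the E binder `hLiu` VERBATIM from its small-level form.**  For the E term instantiate `T` at
`thetaModelOf …` and `U` at `picardCMUniverse …`; the conclusion is then literally the type of `hLiu` in
`Model.perL_picardCM_rNcore` (RUN-37 E re-cut: the `hsmall`/`hLiu` texts in the (W1) `K`-order), `hΘ` is the type of the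
(W1)-re-typed `Model.thetaSatOf … hA` (E's former binder `thetaSat`, = `T.Fact_coverTheta` along `K`-inclusions, §60), and
`D` is indexed by `Model.coverOf … hA Γ Γ₁ h`, `h : Γ₁.Γ ≤ Γ.Γ` (`Model/HLiuOfSmall.lean`). -/
theorem thetaAlbanese_of_small
    (D : ∀ {L : CMField} {ι₁ : L →+* ℂ} {V : HermSpace3 L ι₁} (Γ Γ₁ : Level V) (h : Γ₁.Γ ≤ Γ.Γ),
      U.LevelTransfer (T.cover Γ Γ₁ h))
    (hΘ : ∀ {L : CMField} {ι₁ : L →+* ℂ} (V : HermSpace3 L ι₁) (c : SeesawCtx L) (i : Fin 4) (Γ Γ' : Level V)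
      (h : Γ' ≤ Γ), ∀ η ∈ T.Theta V c i Γ, U.pullC (T.cover Γ Γ' (Level.Γ_mono h)) 1 η ∈ T.Theta V c i Γ')
    (hsmall : ∀ {L : CMField} {ι₁ : L →+* ℂ} (V : HermSpace3 L ι₁) (c : SeesawCtx L),
      T.GoodCtx ι₁ c → Module.finrank ℚ c.K = 6 → ∀ i : Fin 4, ∃ Γ₀ : Level V, ∀ Γ ≤ Γ₀,
        ∃ (M : CMField) (k : c.K →+* M) (σ' : M →+* ℂ), σ'.comp k = c.σ ∧
          T.Theta V c i Γ ⊆ U.Uiso Γ M (inflate k (c.Ψ i)) σ') :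
    ∀ {L : CMField} {ι₁ : L →+* ℂ} (V : HermSpace3 L ι₁) (c : SeesawCtx L),
      T.GoodCtx ι₁ c → Module.finrank ℚ c.K = 6 → ∀ (i : Fin 4) (Γ : Level V),
        ∃ (M : CMField) (k : c.K →+* M) (σ' : M →+* ℂ), σ'.comp k = c.σ ∧
          T.Theta V c i Γ ⊆ U.Uiso Γ M (inflate k (c.Ψ i)) σ' :=
  fun V c hc h6 i Γ => T.isotypic_of_small D V c i (hΘ V c i) (hsmall V c hc h6 i) Γ

/-- The same for the unrestricted interface fact `ThetaModel.Fact_thetaAlbanese` (no sextic hypothesis). -/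
theorem fact_thetaAlbanese_of_small
    (D : ∀ {L : CMField} {ι₁ : L →+* ℂ} {V : HermSpace3 L ι₁} (Γ Γ₁ : Level V) (h : Γ₁.Γ ≤ Γ.Γ),
      U.LevelTransfer (T.cover Γ Γ₁ h))
    (hΘ : ∀ {L : CMField} {ι₁ : L →+* ℂ} (V : HermSpace3 L ι₁) (c : SeesawCtx L) (i : Fin 4) (Γ Γ' : Level V)
      (h : Γ' ≤ Γ), ∀ η ∈ T.Theta V c i Γ, U.pullC (T.cover Γ Γ' (Level.Γ_mono h)) 1 η ∈ T.Theta V c i Γ')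
    (hsmall : ∀ {L : CMField} {ι₁ : L →+* ℂ} (V : HermSpace3 L ι₁) (c : SeesawCtx L),
      T.GoodCtx ι₁ c → ∀ i : Fin 4, ∃ Γ₀ : Level V, ∀ Γ ≤ Γ₀,
        ∃ (M : CMField) (k : c.K →+* M) (σ' : M →+* ℂ), σ'.comp k = c.σ ∧
          T.Theta V c i Γ ⊆ U.Uiso Γ M (inflate k (c.Ψ i)) σ') :
    T.Fact_thetaAlbanese :=
  fun V c hc i Γ => T.isotypic_of_small D V c i (hΘ V c i) (hsmall V c hc i) Γ

end ThetaModel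

end Universe

end HodgeCM

end
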